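import Literature.MathematicalPhysics.QuantumFieldTheory.Balaban1983to89.B16RatioResummationBound
import HarnessLib

/-!
# LFG^{can}∘ — THE ENGINE ROWS FROM A TWO-GAS EXPANSION (G13, px10 lineage): ★★★ `engineRows_of_twoGas` — the eight ENGINE ROWS consumed by ✓`canIntBody_of_engine`
# (FILE 9) ∕ packaged by ✓`canInt_of_enginePackage` (FILE 10) — footprint map, a.e. RATIO identity per deep history in the vacuum-free hole-anchored covering format,
# continuity, V-locality, majorant, energy row `Π sf · e^{−κμ·#blocks}`, `4 + 2 log 26 ≤ κμ` — CONSTRUCTED AND PROVED from the natural output of a one-step expansion: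
# a Kotecký–Preiss VACUUM gas on connected block unions plus HOLE activities, with the UNNORMALISED identity `ρ(E_Q)·Ξ_v(Λ) = ρ(E_∅)·Σ_S Π h·Ξ_v(Λ compatible with S)`

Cell `ym3-torus` (HUMAN RULING D-0037: rung R3 = continuum `SU(2)` Yang–Mills on `T³` — NOT `d = 4`, NOT infinite volume, NOT a mass gap, NOT the Clay problem); width seat
`ym3-torus-px10` (gen 18); helper of the crux `stmt-QuantumFields-20520` `UnitScaleTilt.FluctuationComparisonRegPrIntL` (`--supports … --as helper`, NOT a proof of it).
THEOREMS ONLY: 0 `def`, 0 `instance`, 0 `notation`, 0 `sorry`, default heartbeats.  GENERIC over the letters (labels `Lab`, bonds `α`, blocks `Blk`, locator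
`π : Lab → α`, block map `blk : α → Blk`, block connectivity `IsConn`, single-bond values `Gv`, the reference measure and window on `α → Gv`, the history densities
`ρ Q`, `ρ₀`): the engine assembly instantiates them with FILE 9's letters BY UNIFICATION (`π l := ⟨siteShift … (blkIter (K − J − l.1) l.2.src), l.2.μ⟩`, `blk b :=
iterBlockOf μ b.src`, `IsConn Fc := (touchingGraph SiteTouch).induce Fc).Connected`, `ρ Q := heightDensity F γ hJK (histEvent … Q)`, `ρ₀ := heightDensity … histGood`,
`sf l := if l.1 < K − J then smallFactor F.L γ b₀ p₀ a (K − l.1) else 0`).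

THE TWO-GAS ROWS (hypotheses; print's objects: [Balaban1985UV3] Thm 2 (43)–(47) = the one-step expansion with vacuum polymers AND holes, [Balaban1989LargeFieldII]
(1.72)∕(1.84)).  A catalogue `Λ` of non-empty vacuum polymers, each the bond set of a connected block family; vacuum activities `v U X` (real, V-local, continuous on the
window `W`) obeying the global Kotecký–Preiss condition (1) on `W` with size `τ·#blocks` and decay `κ′·#blocks` (only their values on `Λ` enter the
identity); connected block families sharing a block have connected union (`hconn`); hole activities `h₂ Q′ X U` (real,
V-local, continuous on `W`) bounded on `W` by `(Π_{l ∈ Q′} sf₂ l)·e^{−κ_h·#blocks X}`; the block-animal entropy row `Σ_{X ∋ b, connected block union} e^{−κ_e·#blocks X} ≤ 1`;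
numeric rows `4 + 2·log 26 ≤ κ′`, `0 < τ`, `κ′ + e^{τ∕κ′}·τ + κ_e ≤ κ_h`, `0 ≤ sf₂ l ≤ 1`, `sf₂ l·e ≤ sf l` on deep labels; and THE IDENTITY: for every deep history
`Q`, a.e. on `W`, `ρ Q U · Ξ_{v U}(Λ) = ρ₀ U · Σ_{S compatible admissible hole families covering the located holes of Q} (Π_{X∈S} h₂ (Q↾X) X U) · Ξ_{v U}(vacCompat Λ S)`.

THE CONSTRUCTION (inside the proof, def-free): `Adm Q′ X :=` the footprint clause itself; `ζ Q′ X U := Re holeAct (admOf Q′) Λ (π '' Q′) (h₂ (Q′↾·) · U) (v U ·) X` — the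
HOLE-ANCHORED ACTIVITY of ✓`Literature.…B16RatioResummationDefs`; `ζbar Q′ X :=` the energy row's right-hand side; `κμ := κ′`.  THE PROOF: `hrat` = ✓`decorated_gas_eq_vacuum_mul_holeAnchored`
(B16 (1.90)–(1.91) ratio form) + cancellation of `Ξ_v(Λ) ≠ 0` (KP) + hole-data locality ✓`holeAct_congr_left` (the activity of `X` under `Q` only sees `Q↾X`) + re-indexing of the
hole-chain families by the footprint clause (✓`holeAct_eq_zero_of_not_isHoleChain`, ✓`IsHoleChain.induct` for «connected block union», ✓`IsHoleChain.exists_adm_subset`);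
`hζc` = ✓`continuousOn_holeAct`; `hloc` = ✓`holeAct_congr`; `hdom` = ✓`norm_holeAct_le` ((1.97)-type bound) with `sf_b := Π_{l ∈ Q′, π l = b} sf₂ l`; `hζ0`, `hζ` by construction.

HONEST — WHAT THIS IS NOT.  The two-gas rows are Bałaban's one-step cluster expansion of the constrained fibre integral with its vacuum gas — XL, OPEN, NOT proved here or
anywhere in the tree; this file only removes from the engine's burden everything AFTER that expansion (ratio, Mayer, component resummation, activity bookkeeping).  CURRENCY
CAVEAT inherited (№229): V-locality in `U` (rows `hvloc`, `hhloc`) vs print's background locality.  LFG^{can}∘ ∕ `stub_largeFieldFourPtIntCan` ∕ S2β ∕ the crux 20520 NOT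
proved; `YM3TorusSU2` NOT proved; finite volume ∕ conditional; the Yang–Mills mass gap (Clay) NOT proved; rung R3 = YM₃ on `T³` — NOT `d = 4`, NOT infinite volume, NOT a mass gap.
References: [Balaban1985UV3] T. Bałaban, CMP 102 (1985): (43)–(47) pp.266–267, (67)–(71) pp.273–274; [Balaban1989LargeFieldII] CMP 122 (1989): (1.72) p.379, (1.84) p.386,
(1.90)–(1.91) p.388, (1.97)–(1.101) pp.389–390; [KoteckyPreiss1986] CMP 103 (1986), Theorem p.492 (1), (4), (5).
-/

set_option autoImplicit false

noncomputable section

open Finset MeasureTheory Filter Topology Set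
open scoped BigOperators
open Literature.Probability.LatticeModels
open Literature.MathematicalPhysics.QuantumFieldTheory.Balaban1983to89.B16RatioResummation

namespace Summit.QuantumFields.YangMills.Theorems.FluctuationComparisonRegPrIntLLargeFieldGasEngineOfTwoGas

universe u v w x

variable {Lab : Type u} {α : Type v} {Blk : Type w} {Gv : Type x}
variable [Fintype Lab] [DecidableEq Lab] [Fintype α] [DecidableEq α] [DecidableEq Blk] [TopologicalSpace Gv] [MeasurableSpace Gv]

open Classical in
/-- ★★★ **THE ENGINE ROWS FROM A TWO-GAS EXPANSION.**  Given, at one scale pair and one grain (letters abstract: locator `π`, deep labels `deep`, block map `blk`, block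
connectivity `IsConn`, reference measure `P` and window `W` on the bond fields `α → Gv`, history densities `ρ Q` and the small-history density `ρ₀`, output small factors `sf`):
a Kotecký–Preiss VACUUM gas `v` on the catalogue `Λ` of non-empty connected block unions (V-local, continuous on `W`, (1) with size `τ·#blocks` and decay
`κ′·#blocks`), HOLE activities `h₂` (V-local, continuous, `≤ (Π sf₂)·e^{−κ_h·#blocks}` on `W`), the block-animal entropy row, numeric rows, and the UNNORMALISED a.e.
identity `ρ_Q·Ξ_v(Λ) = ρ₀·Σ_S (Π h₂)·Ξ_v(vacCompat Λ S)` per deep history — THEN the eight ENGINE ROWS of ✓`canIntBody_of_engine` hold for the CONSTRUCTED footprint map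
`Adm`, activities `ζ Q′ X U := Re (holeAct …)` (the hole-anchored activities of [Balaban1989LargeFieldII] (1.90)–(1.91) in ratio form), majorant `ζbar :=` the energy
row, and `κμ := κ′`. [cite: Balaban1989LargeFieldII, (1.72) p.379, (1.90)-(1.91) p.388 and (1.97)-(1.100) pp.389-390; Balaban1985UV3, (43)-(47) pp.266-267; KoteckyPreiss1986, Theorem p.492 (1), (4) and (5)] -/
theorem engineRows_of_twoGas (P : Measure (α → Gv)) (W : Set (α → Gv))
    (π : Lab → α) (deep : Lab → Prop) (blk : α → Blk) (IsConn : Finset Blk → Prop)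
    (ρ : Finset Lab → (α → Gv) → ℝ) (ρ₀ : (α → Gv) → ℝ) (sf sf₂ : Lab → ℝ)
    (Λ : Finset (Finset α)) (v : (α → Gv) → Finset α → ℝ) (h₂ : Finset Lab → Finset α → (α → Gv) → ℝ)
    {τ κ' κh κe : ℝ}
    -- the catalogue: non-empty connected block unions
    (hΛ : ∀ γ ∈ Λ, γ.Nonempty ∧ ∃ Fc : Finset Blk, IsConn Fc ∧ Fc.biUnion (fun y => Finset.univ.filter (fun b : α => blk b = y)) = γ)
    -- connected block families sharing a block have a connected union
    (hconn : ∀ Fc Fc' : Finset Blk, IsConn Fc → IsConn Fc' → (Fc ∩ Fc').Nonempty → IsConn (Fc ∪ Fc'))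
    -- the vacuum activities: V-local, continuous on the window, Kotecký–Preiss (1) with `a = τ·#blocks`, `d = κ′·#blocks` (only their values on `Λ` enter)
    (hvloc : ∀ (X : Finset α) (U U' : α → Gv), (∀ e ∈ X, U e = U' e) → v U X = v U' X)
    (hvc : ∀ X : Finset α, ContinuousOn (fun U => v U X) W)
    (hKP : ∀ U ∈ W, ∀ σ : Finset α, ∑ γ' ∈ Finset.univ.filter (fun γ' : Finset α => polyInc γ' σ),
      |v U γ'| * Real.exp (τ * (((γ'.image blk).card : ℕ) : ℝ) + κ' * (((γ'.image blk).card : ℕ) : ℝ)) ≤ τ * (((σ.image blk).card : ℕ) : ℝ))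
    -- the hole activities: V-local, continuous on the window, one input small factor per hole and block decay
    (hhloc : ∀ (Q' : Finset Lab) (X : Finset α) (U U' : α → Gv), (∀ e ∈ X, U e = U' e) → h₂ Q' X U = h₂ Q' X U')
    (hhc : ∀ (Q' : Finset Lab) (X : Finset α), ContinuousOn (fun U => h₂ Q' X U) W)
    (hhbd : ∀ (Q' : Finset Lab) (X : Finset α) (U : α → Gv), U ∈ W → (∀ l ∈ Q', deep l) →
      |h₂ Q' X U| ≤ (∏ l ∈ Q', sf₂ l) * Real.exp (-(κh * (((X.image blk).card : ℕ) : ℝ))))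
    -- the entropy of connected block unions through a bond
    (hent : ∀ b : α, ∑ X ∈ Finset.univ.filter (fun X : Finset α => b ∈ X ∧ ∃ Fc : Finset Blk, IsConn Fc ∧
        Fc.biUnion (fun y => Finset.univ.filter (fun b : α => blk b = y)) = X), Real.exp (-(κe * (((X.image blk).card : ℕ) : ℝ))) ≤ 1)
    -- numeric rows
    (hκ' : 4 + 2 * Real.log 26 ≤ κ') (hτ : 0 < τ) (hκh : κ' + Real.exp (τ / κ') * τ + κe ≤ κh)
    (hsf₂ : ∀ l, 0 ≤ sf₂ l ∧ sf₂ l ≤ 1) (hsf : ∀ l, deep l → sf₂ l * Real.exp 1 ≤ sf l)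
    -- THE TWO-GAS IDENTITY per deep history, a.e. on the window
    (h2g : ∀ Q : Finset Lab, (∀ l ∈ Q, deep l) → ∀ᵐ U ∂P, U ∈ W →
      (ρ Q U : ℂ) * polymerPartitionFunction polyInc (fun γ => ((v U γ : ℝ) : ℂ)) Λ =
        (ρ₀ U : ℂ) * ∑ S ∈ (Finset.univ : Finset (Finset α)).powerset.filter
            (IsHoleFamily (fun X => (∃ l ∈ Q, π l ∈ X) ∧ ∃ Fc : Finset Blk, IsConn Fc ∧
              Fc.biUnion (fun y => Finset.univ.filter (fun b : α => blk b = y)) = X) (Q.image π)),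
          (∏ X ∈ S, ((h₂ (Q.filter fun l => π l ∈ X) X U : ℝ) : ℂ)) *
            polymerPartitionFunction polyInc (fun γ => ((v U γ : ℝ) : ℂ)) (vacCompat Λ S)) :
    ∃ (Adm : Finset Lab → Finset α → Prop) (ζ : Finset Lab → Finset α → (α → Gv) → ℝ) (ζbar : Finset Lab → Finset α → ℝ) (κmu : ℝ),
      -- footprint map
      (∀ Q' X, Adm Q' X → Q'.Nonempty ∧ (∀ l ∈ Q', deep l ∧ π l ∈ X) ∧
        ∃ Fc : Finset Blk, IsConn Fc ∧ Fc.biUnion (fun y => Finset.univ.filter (fun b : α => blk b = y)) = X) ∧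
      -- the a.e. ratio identity of the expansion with holes, per deep history, on the window
      (∀ Q : Finset Lab, (∀ l ∈ Q, deep l) → ∀ᵐ U ∂P, U ∈ W →
        ρ Q U = ρ₀ U * ∑ 𝒳 ∈ (Finset.univ : Finset (Finset α)).powerset.filter (fun 𝒳 => IsCompatible polyInc 𝒳 ∧
            (∀ l ∈ Q, ∃ X ∈ 𝒳, π l ∈ X) ∧ ∀ X ∈ 𝒳, Adm (Q.filter fun l => π l ∈ X) X),
          ∏ X ∈ 𝒳, ζ (Q.filter fun l => π l ∈ X) X U) ∧
      -- continuous, V-local activities with a window-uniform majorant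
      (∀ Q' X, Adm Q' X → ContinuousOn (fun U => ζ Q' X U) W) ∧
      (∀ Q' X (U U' : α → Gv), Adm Q' X → (∀ e ∈ X, U e = U' e) → ζ Q' X U = ζ Q' X U') ∧
      (∀ Q' X U, Adm Q' X → U ∈ W → |ζ Q' X U| ≤ ζbar Q' X) ∧
      (∀ Q' X, Adm Q' X → 0 ≤ ζbar Q' X) ∧
      -- the energy bound: one small factor per hole, tree decay per block
      (∀ Q' X, Adm Q' X → ζbar Q' X ≤ (∏ l ∈ Q', sf l) * Real.exp (-(κmu * (((X.image blk).card : ℕ) : ℝ)))) ∧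
      -- tree decay per block beats the entropy of block animals
      4 + 2 * Real.log 26 ≤ κmu := by
  -- ══════ the letters of the construction ══════
  -- the size: number of blocks met
  have hsz0 : ∀ X : Finset α, (0 : ℝ) ≤ (((X.image blk).card : ℕ) : ℝ) := fun X => Nat.cast_nonneg _
  have hsze : ((((∅ : Finset α).image blk).card : ℕ) : ℝ) = 0 := by simp
  have hszu : ∀ A B : Finset α, ((((A ∪ B).image blk).card : ℕ) : ℝ) ≤ (((A.image blk).card : ℕ) : ℝ) + (((B.image blk).card : ℕ) : ℝ) := by
    intro A B
    rw [Finset.image_union]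
    exact_mod_cast Finset.card_union_le _ _
  have hκ'0 : 0 < κ' := by
    have h26 : (0 : ℝ) < 2 * Real.log 26 := by positivity
    linarith
  -- membership in the cells of a block family
  have hcells : ∀ (Fc : Finset Blk) (b : α), b ∈ Fc.biUnion (fun y => Finset.univ.filter (fun b : α => blk b = y)) ↔ blk b ∈ Fc := by
    intro Fc b
    simp only [Finset.mem_biUnion, Finset.mem_filter, Finset.mem_univ, true_and]
    exact ⟨fun ⟨y, hy, hby⟩ => hby ▸ hy, fun hb => ⟨blk b, hb, rfl⟩⟩
  -- «connected block union» is stable under unions of meeting bond sets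
  have hgood_union : ∀ A B : Finset α,
      (∃ Fc : Finset Blk, IsConn Fc ∧ Fc.biUnion (fun y => Finset.univ.filter (fun b : α => blk b = y)) = A) →
      (∃ Fc : Finset Blk, IsConn Fc ∧ Fc.biUnion (fun y => Finset.univ.filter (fun b : α => blk b = y)) = B) →
      (A ∩ B).Nonempty →
      ∃ Fc : Finset Blk, IsConn Fc ∧ Fc.biUnion (fun y => Finset.univ.filter (fun b : α => blk b = y)) = A ∪ B := by
    rintro A B ⟨Fa, hFa, rfl⟩ ⟨Fb, hFb, rfl⟩ ⟨b, hb⟩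
    obtain ⟨hbA, hbB⟩ := Finset.mem_inter.1 hb
    refine ⟨Fa ∪ Fb, hconn Fa Fb hFa hFb ⟨blk b, Finset.mem_inter.2 ⟨(hcells Fa b).1 hbA, (hcells Fb b).1 hbB⟩⟩, ?_⟩
    rw [Finset.union_biUnion]
  -- real casts of the activities
  have hvC_norm : ∀ (U : α → Gv) (γ : Finset α), ‖(((v U γ : ℝ)) : ℂ)‖ = |v U γ| := fun U γ => by
    rw [Complex.norm_real, Real.norm_eq_abs]
  -- the Kotecký–Preiss condition of the complexified vacuum activities, in the (a, d) form and as a finite-volume condition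
  have hKPC : ∀ U ∈ W, ∀ σ : Finset α, ∑ γ' ∈ Finset.univ.filter (fun γ' : Finset α => polyInc γ' σ),
      ‖(((v U γ' : ℝ)) : ℂ)‖ * Real.exp (τ * (((γ'.image blk).card : ℕ) : ℝ) + κ' * (((γ'.image blk).card : ℕ) : ℝ)) ≤
        τ * (((σ.image blk).card : ℕ) : ℝ) := by
    intro U hU σ
    simpa only [hvC_norm] using hKP U hU σ
  have hKPvol : ∀ U ∈ W, IsKPVolume polyInc (fun γ => (((v U γ : ℝ)) : ℂ)) (fun X => τ * (((X.image blk).card : ℕ) : ℝ)) Λ :=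
    fun U hU => isKPVolume_of_kp (d := fun X => κ' * (((X.image blk).card : ℕ) : ℝ)) (fun X => mul_nonneg hκ'0.le (hsz0 X)) (hKPC U hU) Λ
  have hΛne : ∀ γ ∈ Λ, γ.Nonempty := fun γ hγ => (hΛ γ hγ).1
  -- ══════ THE CONSTRUCTION ══════
  refine ⟨fun Q' X => Q'.Nonempty ∧ (∀ l ∈ Q', deep l ∧ π l ∈ X) ∧
      ∃ Fc : Finset Blk, IsConn Fc ∧ Fc.biUnion (fun y => Finset.univ.filter (fun b : α => blk b = y)) = X,
    fun Q' X U => (holeAct (fun Y => (∃ l ∈ Q', π l ∈ Y) ∧ ∃ Fc : Finset Blk, IsConn Fc ∧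
        Fc.biUnion (fun y => Finset.univ.filter (fun b : α => blk b = y)) = Y) Λ (Q'.image π)
      (fun Y => (((h₂ (Q'.filter fun l => π l ∈ Y) Y U : ℝ)) : ℂ)) (fun γ => (((v U γ : ℝ)) : ℂ)) X).re,
    fun Q' X => (∏ l ∈ Q', sf l) * Real.exp (-(κ' * (((X.image blk).card : ℕ) : ℝ))), κ',
    fun Q' X h => h, ?_, ?_, ?_, ?_, ?_, fun Q' X _ => le_rfl, hκ'⟩
  · -- ══════ (R2) THE RATIO IDENTITY ══════
    intro Q hQ
    filter_upwards [h2g Q hQ] with U hU hUW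
    have h2 := hU hUW
    beta_reduce
    -- the hole-anchored resummation of the two-gas right-hand side
    have hadm : ∀ X : Finset α, ((∃ l ∈ Q, π l ∈ X) ∧ ∃ Fc : Finset Blk, IsConn Fc ∧
        Fc.biUnion (fun y => Finset.univ.filter (fun b : α => blk b = y)) = X) → X.Nonempty :=
      fun X hX => by obtain ⟨⟨l, -, hl⟩, -⟩ := hX; exact ⟨π l, hl⟩
    have hId := decorated_gas_eq_vacuum_mul_holeAnchored
      (fun X => (∃ l ∈ Q, π l ∈ X) ∧ ∃ Fc : Finset Blk, IsConn Fc ∧ Fc.biUnion (fun y => Finset.univ.filter (fun b : α => blk b = y)) = X)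
      hadm hΛne (hKPvol U hUW) (Q.image π) (fun Y => (((h₂ (Q.filter fun l => π l ∈ Y) Y U : ℝ)) : ℂ))
    rw [hId] at h2
    have hΞ : polymerPartitionFunction polyInc (fun γ => (((v U γ : ℝ)) : ℂ)) Λ ≠ 0 :=
      polymerPartitionFunction_ne_zero_of_kp (hKPvol U hUW) (Finset.Subset.refl _)
    have h3 : (ρ Q U : ℂ) = (ρ₀ U : ℂ) *
        ∑ 𝒴 ∈ (Finset.univ : Finset (Finset α)).powerset.filter (IsChainFamily
            (fun X => (∃ l ∈ Q, π l ∈ X) ∧ ∃ Fc : Finset Blk, IsConn Fc ∧ Fc.biUnion (fun y => Finset.univ.filter (fun b : α => blk b = y)) = X)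
            Λ (Q.image π)),
          ∏ Y ∈ 𝒴, holeAct (fun X => (∃ l ∈ Q, π l ∈ X) ∧ ∃ Fc : Finset Blk, IsConn Fc ∧
              Fc.biUnion (fun y => Finset.univ.filter (fun b : α => blk b = y)) = X) Λ (Q.image π)
            (fun Y => (((h₂ (Q.filter fun l => π l ∈ Y) Y U : ℝ)) : ℂ)) (fun γ => (((v U γ : ℝ)) : ℂ)) Y := by
      apply mul_right_cancel₀ hΞ
      rw [h2]; ring
    -- Step B: each factor is the (real) activity of `X` under the holes located in `X`
    have hstepB : ∀ X : Finset α,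
        holeAct (fun X => (∃ l ∈ Q, π l ∈ X) ∧ ∃ Fc : Finset Blk, IsConn Fc ∧
            Fc.biUnion (fun y => Finset.univ.filter (fun b : α => blk b = y)) = X) Λ (Q.image π)
          (fun Y => (((h₂ (Q.filter fun l => π l ∈ Y) Y U : ℝ)) : ℂ)) (fun γ => (((v U γ : ℝ)) : ℂ)) X =
        (((holeAct (fun Y => (∃ l ∈ Q.filter (fun l => π l ∈ X), π l ∈ Y) ∧ ∃ Fc : Finset Blk, IsConn Fc ∧
            Fc.biUnion (fun y => Finset.univ.filter (fun b : α => blk b = y)) = Y) Λ ((Q.filter fun l => π l ∈ X).image π)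
          (fun Y => (((h₂ ((Q.filter fun l => π l ∈ X).filter fun l => π l ∈ Y) Y U : ℝ)) : ℂ)) (fun γ => (((v U γ : ℝ)) : ℂ)) X).re : ℝ) : ℂ) := by
      intro X
      -- hole-data locality, then hole-activity locality
      have hQQ : ∀ Y, Y ⊆ X → (Q.filter fun l => π l ∈ X).filter (fun l => π l ∈ Y) = Q.filter fun l => π l ∈ Y := by
        intro Y hY
        ext l
        simp only [Finset.mem_filter]
        exact ⟨fun h => ⟨h.1.1, h.2⟩, fun h => ⟨⟨h.1, hY h.2⟩, h.2⟩⟩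
      rw [holeAct_congr_left (adm' := fun Y => (∃ l ∈ Q.filter (fun l => π l ∈ X), π l ∈ Y) ∧ ∃ Fc : Finset Blk, IsConn Fc ∧
            Fc.biUnion (fun y => Finset.univ.filter (fun b : α => blk b = y)) = Y) (Q' := (Q.filter fun l => π l ∈ X).image π)
          (fun Y hY => ?_) (fun b hb => ?_),
        holeAct_congr (h' := fun Y => (((h₂ ((Q.filter fun l => π l ∈ X).filter fun l => π l ∈ Y) Y U : ℝ)) : ℂ))
          (v' := fun γ => (((v U γ : ℝ)) : ℂ)) (fun Y hY => by simp only [hQQ Y hY]) (fun _ _ => rfl)]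
      · -- a real number
        refine Complex.ext (by simp) ?_
        rw [Complex.ofReal_im]
        exact holeAct_im_eq_zero (hKPvol U hUW) (fun _ => Complex.ofReal_im _) (fun _ => Complex.ofReal_im _) X
      · simp only [Finset.mem_filter]
        constructor
        · rintro ⟨⟨l, hl, hlY⟩, hc⟩; exact ⟨⟨l, ⟨hl, hY hlY⟩, hlY⟩, hc⟩
        · rintro ⟨⟨l, ⟨hl, -⟩, hlY⟩, hc⟩; exact ⟨⟨l, hl, hlY⟩, hc⟩
      · simp only [Finset.mem_image, Finset.mem_filter]
        constructor
        · rintro ⟨l, hl, rfl⟩; exact ⟨l, ⟨hl, hb⟩, rfl⟩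
        · rintro ⟨l, ⟨hl, -⟩, rfl⟩; exact ⟨l, hl, rfl⟩
    -- Step C: take real parts and re-index the hole-chain families by the footprint clause (other terms vanish)
    have h3re := congrArg Complex.re h3
    rw [Complex.ofReal_re, Complex.re_ofReal_mul, Complex.re_sum] at h3re
    rw [h3re]
    congr 1
    refine Eq.trans (Finset.sum_congr rfl fun 𝒳 _ => ?_) (Finset.sum_subset ?_ ?_)
    · -- the summands: real parts of products of real activities
      rw [Finset.prod_congr rfl fun X _ => hstepB X, ← Complex.ofReal_prod, Complex.ofReal_re]
    · -- hole-chain families are admissible covering families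
      intro 𝒴 h𝒴
      simp only [Finset.mem_filter, Finset.mem_powerset] at h𝒴 ⊢
      obtain ⟨h1, hcomp, hcov, hchain⟩ := h𝒴
      refine ⟨h1, hcomp, fun l hl => ?_, fun Y hY => ⟨?_, fun l hl' => ?_, ?_⟩⟩
      · exact hcov (π l) (Finset.mem_image_of_mem π hl)
      · obtain ⟨X, ⟨⟨l, hlQ, hlX⟩, -⟩, -, hXY⟩ := (hchain Y hY).exists_adm_subset
        exact ⟨l, Finset.mem_filter.2 ⟨hlQ, hXY hlX⟩⟩
      · exact ⟨hQ l hl'.1, hl'.2⟩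
      · exact (hchain Y hY).induct (Good := fun Z => ∃ Fc : Finset Blk, IsConn Fc ∧
            Fc.biUnion (fun y => Finset.univ.filter (fun b : α => blk b = y)) = Z)
          (fun X hX _ => hX.2) (fun γ hγ => (hΛ γ hγ).2) hgood_union
    · -- the other admissible covering families carry a vanishing factor
      intro 𝒳 h𝒳 hnot
      simp only [Finset.mem_filter, Finset.mem_powerset] at h𝒳 hnot
      obtain ⟨h1, hcomp, hcov, hadmX⟩ := h𝒳
      have hgc : GCov (Q.image π) 𝒳 := by
        intro b hb
        obtain ⟨l, hl, rfl⟩ := Finset.mem_image.1 hb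
        exact hcov l hl
      have : ¬ ∀ Y ∈ 𝒳, IsHoleChain (fun X => (∃ l ∈ Q, π l ∈ X) ∧ ∃ Fc : Finset Blk, IsConn Fc ∧
          Fc.biUnion (fun y => Finset.univ.filter (fun b : α => blk b = y)) = X) Λ Y :=
        fun hall => hnot ⟨h1, hcomp, hgc, hall⟩
      push Not at this
      obtain ⟨Y, hY, hYn⟩ := this
      refine Finset.prod_eq_zero hY ?_
      have hB := hstepB Y
      rw [holeAct_eq_zero_of_not_isHoleChain hYn] at hB
      exact_mod_cast hB.symm
  · -- ══════ (R3) continuity on the window ══════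
    intro Q' X _
    refine Complex.continuous_re.comp_continuousOn ?_
    refine continuousOn_holeAct _ (Q'.image π) (hf := fun U Y => (((h₂ (Q'.filter fun l => π l ∈ Y) Y U : ℝ)) : ℂ))
      (vf := fun U γ => (((v U γ : ℝ)) : ℂ)) (a := fun X => τ * (((X.image blk).card : ℕ) : ℝ)) (fun Y => ?_) (fun γ _ => ?_) hKPvol X
    · exact Complex.continuous_ofReal.comp_continuousOn (hhc _ Y)
    · exact Complex.continuous_ofReal.comp_continuousOn (hvc γ)
  · -- ══════ (R4) V-locality ══════
    intro Q' X U U' _ hUU'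
    refine congrArg Complex.re (holeAct_congr (fun Y hY => ?_) (fun γ hγ => ?_))
    · rw [hhloc _ Y U U' fun e he => hUU' e (hY he)]
    · rw [hvloc γ U U' fun e he => hUU' e (hγ he)]
  · -- ══════ (R5) the majorant: the (1.97)-type activity bound ══════
    rintro Q' X U ⟨hQne, hdeep, hXconn⟩ hU
    refine (Complex.abs_re_le_norm _).trans ?_
    -- the bound of `B16RatioResummationBound` with `sf_b := Π_{l ∈ Q', π l = b} sf₂ l`, `a := τ·#blocks`, `d := κ′·#blocks`, `A₀ := τ∕κ′`, `ε := 1`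
    have hA₀ : ∀ γ ∈ Λ, τ * (((γ.image blk).card : ℕ) : ℝ) * Real.exp (-(κ' * (((γ.image blk).card : ℕ) : ℝ))) ≤ τ / κ' := by
      intro γ _
      set n : ℝ := (((γ.image blk).card : ℕ) : ℝ)
      have hy : κ' * n * Real.exp (-(κ' * n)) ≤ 1 := by
        have h1 := Real.add_one_le_exp (κ' * n)
        have h2 := Real.exp_pos (-(κ' * n))
        have h3 : Real.exp (κ' * n) * Real.exp (-(κ' * n)) = 1 := by rw [← Real.exp_add, add_neg_cancel, Real.exp_zero]
        nlinarith
      calc τ * n * Real.exp (-(κ' * n)) = τ / κ' * (κ' * n * Real.exp (-(κ' * n))) := by field_simp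
        _ ≤ τ / κ' * 1 := mul_le_mul_of_nonneg_left hy (div_nonneg hτ.le hκ'0.le)
        _ = τ / κ' := mul_one _
    have hsfb0 : ∀ b : α, 0 ≤ ∏ l ∈ Q'.filter (fun l => π l = b), sf₂ l := fun b => Finset.prod_nonneg fun l _ => (hsf₂ l).1
    have hsfb1 : ∀ b : α, ∏ l ∈ Q'.filter (fun l => π l = b), sf₂ l ≤ 1 := fun b => Finset.prod_le_one (fun l _ => (hsf₂ l).1) fun l _ => (hsf₂ l).2
    have hbound := norm_holeAct_le
      (adm := fun Y => (∃ l ∈ Q', π l ∈ Y) ∧ ∃ Fc : Finset Blk, IsConn Fc ∧ Fc.biUnion (fun y => Finset.univ.filter (fun b : α => blk b = y)) = Y)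
      (Λ := Λ) (Q := Q'.image π) (h := fun Y => (((h₂ (Q'.filter fun l => π l ∈ Y) Y U : ℝ)) : ℂ)) (v := fun γ => (((v U γ : ℝ)) : ℂ))
      (sz := fun X => (((X.image blk).card : ℕ) : ℝ)) (sf := fun b => ∏ l ∈ Q'.filter (fun l => π l = b), sf₂ l)
      (κh := κh) (κ' := κ') (τ := τ) (A₀ := τ / κ') (ε := 1)
      (a := fun X => τ * (((X.image blk).card : ℕ) : ℝ)) (d := fun X => κ' * (((X.image blk).card : ℕ) : ℝ))
      hsze hszu hκ'0.le hsfb0 hsfb1 ?_ ?_ (fun X => mul_nonneg hτ.le (hsz0 X)) (fun X => mul_nonneg hκ'0.le (hsz0 X)) (hKPC U hU)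
      (fun X _ => le_rfl) (fun γ _ => le_rfl) hA₀ ?_ X
    rotate_left
    · -- every admissible hole polymer contains a located hole
      rintro Y ⟨⟨l, hl, hlY⟩, -⟩
      exact ⟨π l, Finset.mem_inter.2 ⟨Finset.mem_image_of_mem π hl, hlY⟩⟩
    · -- the hole activity bound, fibred over the located holes
      rintro Y ⟨-, -⟩
      have hdeepf : ∀ l ∈ Q'.filter (fun l => π l ∈ Y), deep l := fun l hl => (hdeep l (Finset.mem_filter.1 hl).1).1
      have hmaps : ∀ l ∈ Q'.filter (fun l => π l ∈ Y), π l ∈ Q'.image π ∩ Y := fun l hl =>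
        Finset.mem_inter.2 ⟨Finset.mem_image_of_mem π (Finset.mem_filter.1 hl).1, (Finset.mem_filter.1 hl).2⟩
      have hfib : ∏ l ∈ Q'.filter (fun l => π l ∈ Y), sf₂ l =
          ∏ b ∈ Q'.image π ∩ Y, ∏ l ∈ Q'.filter (fun l => π l = b), sf₂ l := by
        rw [← Finset.prod_fiberwise_of_maps_to hmaps]
        refine Finset.prod_congr rfl fun b hb => Finset.prod_congr ?_ fun _ _ => rfl
        ext l
        simp only [Finset.mem_filter]
        constructor
        · rintro ⟨⟨hl, -⟩, hlb⟩; exact ⟨hl, hlb⟩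
        · rintro ⟨hl, hlb⟩; exact ⟨⟨hl, hlb ▸ (Finset.mem_inter.1 hb).2⟩, hlb⟩
      change ‖(((h₂ (Q'.filter fun l => π l ∈ Y) Y U : ℝ)) : ℂ)‖ ≤ _
      rw [Complex.norm_real, Real.norm_eq_abs, ← hfib]
      exact hhbd _ Y U hU hdeepf
    · -- the entropy row
      intro b _
      have hκe : κe ≤ κh - κ' - Real.exp (τ / κ') * τ := by linarith
      refine (Finset.sum_le_sum (g := fun X : Finset α => Real.exp (-(κe * (((X.image blk).card : ℕ) : ℝ))))
        fun X _ => Real.exp_le_exp.2 (by nlinarith [hsz0 X])).trans ?_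
      refine le_trans (Finset.sum_le_sum_of_subset_of_nonneg ?_ fun X _ _ => Real.exp_nonneg _) (hent b)
      intro X hX
      simp only [Finset.mem_filter, Finset.mem_univ, true_and] at hX ⊢
      exact ⟨hX.2, hX.1.2⟩
    · -- from the bound to the energy row's right-hand side
      refine hbound.trans (mul_le_mul_of_nonneg_right ?_ (Real.exp_nonneg _))
      have himg : Q'.image π ∩ X = Q'.image π :=
        Finset.inter_eq_left.2 (Finset.image_subset_iff.2 fun l hl => (hdeep l hl).2)
      rw [himg, Finset.prod_mul_distrib, Finset.prod_const, Finset.prod_fiberwise_of_maps_to (fun l hl => Finset.mem_image_of_mem π hl)]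
      have hP0 : 0 ≤ ∏ l ∈ Q', sf₂ l := Finset.prod_nonneg fun l _ => (hsf₂ l).1
      have he1 : (1 : ℝ) ≤ Real.exp 1 := Real.one_le_exp zero_le_one
      calc (∏ l ∈ Q', sf₂ l) * Real.exp 1 ^ (Q'.image π).card
          ≤ (∏ l ∈ Q', sf₂ l) * Real.exp 1 ^ Q'.card :=
            mul_le_mul_of_nonneg_left (pow_le_pow_right₀ he1 Finset.card_image_le) hP0
        _ = ∏ l ∈ Q', sf₂ l * Real.exp 1 := by rw [Finset.prod_mul_distrib, Finset.prod_const]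
        _ ≤ ∏ l ∈ Q', sf l :=
            Finset.prod_le_prod (fun l _ => mul_nonneg (hsf₂ l).1 (Real.exp_nonneg _)) fun l hl => hsf l (hdeep l hl).1
  · -- ══════ (R6) the majorant is non-negative ══════
    rintro Q' X ⟨-, hdeep, -⟩
    refine mul_nonneg (Finset.prod_nonneg fun l hl => ?_) (Real.exp_nonneg _)
    have h1 := hsf l (hdeep l hl).1
    have h2 : 0 ≤ sf₂ l * Real.exp 1 := mul_nonneg (hsf₂ l).1 (Real.exp_nonneg _)
    linarith

end Summit.QuantumFields.YangMills.Theorems.FluctuationComparisonRegPrIntLLargeFieldGasEngineOfTwoGas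

end
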